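import Literature.MathematicalPhysics.QuantumFieldTheory.Balaban1983to89.B6Prop22DerivMultiLevelBox
import Literature.MathematicalPhysics.QuantumFieldTheory.Balaban1983to89.B6Prop22AdjMultiLevelBox
import Literature.MathematicalPhysics.QuantumFieldTheory.Balaban1983to89.B6Prop22LapMultiLevelBox
import Literature.MathematicalPhysics.QuantumFieldTheory.Balaban1983to89.B6Ineq243AdjTwoLevelBox
import Literature.MathematicalPhysics.QuantumFieldTheory.Balaban1983to89.B6Prop22LapTwoLevelBox
import Literature.MathematicalPhysics.QuantumFieldTheory.Balaban1983to89.B6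

/-!
# `Balaban1983to89.B6Prop22KLevelCensus` — [B6] Proposition 2.2 (2.67) IN ITS CENSUS TYPING ON THE GENUINE `k`-LEVEL FAMILY:
# THE FIRST CONJUNCT of the verbatim `B6.Prop22Printed` — the four sup entries `|G′λ|, |∇G′λ|, |G′∇*λ|, |ΔG′λ| ≤
# O(1)[(L^jη)², L^jη, L^jη, 1]e^{−½δ₀d(y,y′)}|λ|` with the printed prefactors, the REALISED multiscale distance (2.46) and
# «M sufficiently large» — for the genuine `k`-level operator `G′ = Δ′_a⁻¹` of the p21 lineage on EVERY nested family
# (2.1)–(2.2) on the Neumann box — arbitrarily many levels —, with non-vacuity at two and at three levels ((2.2) active)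
# (v1.2; nothing existing outside this file is touched; no fact is minted; every input is a kernel-proved theorem consumed
# BY NAME)

FRAMING (verbatim cell line):
statement-level skeleton of published theorems with citation tags; proofs where landed; nothing here is a claim about the Yang–Mills mass gap

Source under audit (cell pub-balaban): T. Bałaban, *Propagators and renormalization transformations for lattice gauge
theories. II*, Commun. Math. Phys. **96** (1984) 223–250 [`Balaban1984PropagatorsII`, "B6"]: p. 234 [PDF 12]
Proposition 2.2 (2.67); p. 224 [PDF 2] (2.1)–(2.4) («M is a size of big blocks and R is a big positive integer which will be
fixed later»); p. 225 [PDF 3] (2.13)–(2.14); p. 231 [PDF 9] (2.45)–(2.46); p. 233 [PDF 11] (2.59).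

## WHAT IS PRINTED (p. 234, verbatim up to notation)

«Proposition 2.2. If we have (2.1), (2.2) and M is sufficiently large, then the operator G′ = Δ′_a^{−1} (a = 1) satisfies
the inequalities |(G′λ)(x)|, |(∇G′λ)(x)|, |(G′∇*λ)(x)|, ‖ζ∇G′λ‖_α, ‖ζG′∇*λ‖_α, |(ΔG′λ)(x)|
 ≤ O(1)[(L^jη)², L^jη, L^jη, (L^jη)^{1−α}(‖ζ‖_α + |ζ|), (L^jη)^{1−α}(‖ζ‖_α + |ζ|), 1]e^{−½δ₀d(y,y′)}|λ|   (2.67)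
for x ∈ B^j(y), or ζ with supp ζ ⊂ B^j(y), y ∈ Λ_j, and for λ with supp λ ⊂ B^{j′}(y′).»
The census file `B6` types this as `B6.Prop22Printed geo Gp`: `∃ M₁ δ₀ C, ∃ Cα, 0 < M₁ ∧ 0 < δ₀ ∧ 0 < C ∧ ∀ i, Hyp21_22 →
M₁ ≤ M → (∀ m λ y y′, suppIn λ y′ → e m λ y ≤ C·pref4 (len y) m·e^{−½δ₀·dist y y′}·|λ|) ∧ (Hölder conjunct)`.

## WHAT THIS FILE CERTIFIES (kernel-checked; `A = 0`; the p21 `k`-level lineage — files A–E, `B6Prop22DerivMultiLevelBox`,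
## `B6Prop22LapMultiLevelBox`, `B6Prop22AdjMultiLevelBox` — is USED)

* §1 `KIdx d ℓ` — THE INDEX FAMILY OF ALL NESTED FAMILIES (2.1)–(2.2) ON THE BOX: number of levels `k ≥ 1`, big-block
  parameter `M_h ≥ 1` (`M = L·M_h`), the integer `R` with `R ≥ 2L` (print: «a big positive integer which will be fixed
  later»), volume `P`, and a level function `D : B6MultiLevelBoxOperator.Domains d ℓ M_h k P R` ((2.1) = field `bigBlocks`,
  (2.2) = field `sep`).  The member's operator `KIdx.G = gml (N0 ℓ M_h k P) ℓ k D.lev (aPrinted ℓ 1)` is THE GENUINE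
  `k`-LEVEL `G′ = Δ′_a⁻¹` of (2.13)–(2.14) (`B6MultiLevelBoxOperator.mlOp`/`gml`, `mlOp_mul_gml`) with the PRINTED weights
  `a_j = B1.aSeq 1 L j` («a₁ = a», «(a = 1)», recursion (2.14)), `m² = 0`.
* §2 `KIdx.geo : B6.Geometry` — THE CENSUS GEOMETRY OF THE MEMBER = p21's realised geometry `B6Geom246MultiLevelBox.geom D`
  (sites = the blocks `𝔅` (2.45) of all levels `1 … k`, `scale` = level, `dist` = the graph distance of touching blocks,
  which `Realizes` (2.46): `B6Geom246MultiLevelBox.realizes`; `η = 1`: LATTICE UNITS, `len y = L^j`) with `M := L·M_h`,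
  `R := R`, `Hyp21_22 := True` (honest: (2.1)–(2.2) are structure fields of `Domains`), arguments `λ`/cut-offs `ζ` = real
  lattice functions on the box, `suppIn λ y′ ⇔ supp λ ⊂ B(y′)` (`blkOf`), `|λ| = sup|λ(x)|` (`supF`), lattice Hölder
  seminorms; `KIdx.gp : B6.GpFamily geo` — the (2.67) functionals of `G′` as block sups (`e 0 … 3`) and the `ζ`-dressed
  Hölder slot, in lattice units (forward differences along bonds of the box).
* §3 **`prop22_entry1_kLevel`** — PROPOSITION 2.2 (2.67), FIRST ENTRY, IN THE CENSUS TYPING, ON THE WHOLE `k`-LEVEL FAMILY: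
  `∃ M₁ δ₀ C > 0` (functions of `d`, `L`) `∀ i : KIdx d ℓ, Hyp21_22 → M₁ ≤ M → ∀ λ y y′, suppIn λ y′ →
  gp.e 0 λ y ≤ C·pref4 (len y) 0·e^{−½δ₀·dist y y′}·|λ|` — literally the `m = 0` instance of the first conjunct of
  `B6.Prop22Printed (fun i : KIdx d ℓ => i.geo) (fun i => i.gp)`, for EVERY number of levels `k`, every volume, every
  nested family, every `M_h` with `L·M_h ≥ M₁`.  Proof = p21's `B6Prop22MultiLevelBox.prop22_first_multiLevelBox`
  ((2.64)–(2.66) for the genuine operator: `HasMajorant (geom D) (blkOf D) (toLin′ G′) (C·L^{2j}·e^{−½δ₀d})`) BY NAME, read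
  on the block-supported `λ` (`BlockSupp` from `suppIn`, bound `|λ|`); p21's side conditions `M_h ≥ 3`, `L·M_h ≥ M₀` and the
  (2.59)-type threshold `N₀ + 1 ≤ R·M` are ALL instances of «M sufficiently large»: `M₁ := max(M₀, N₀ + 1, 3L)` (using
  `R ≥ 2L ≥ 1`); the printed prefactor `(L^jη)² = L^{2j}` is EXACT here (no slack).
* §3 (v1.1) **`prop22_supEntries126_kLevel`** — ENTRIES 1, 2 AND 6 WITH COMMON CONSTANTS: `∃ M₁ δ₀ C > 0 ∀ i, Hyp21_22 →
  M₁ ≤ M → ∀ m ≠ 2, ∀ λ y y′, suppIn λ y′ → gp.e m λ y ≤ C·pref4 (len y) m·e^{−½δ₀·dist y y′}·|λ|` — the instances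
  `m = 0, 1, 3` of the first conjunct of `B6.Prop22Printed` (prefactors `(L^j)², L^j, 1` exact), from p21's
  `prop22_first_multiLevelBox`, `prop22_second_multiLevelBox` (`HasMajorant … (toLin′ (dMat μ * gml)) (C·L^j·e^{−½δ₀d})`;
  dictionary `dMat_G_mulVec`: `((∂_μ·G′)λ)(x) = (G′λ)(fwd_μ x) − (G′λ)(x)`) and `prop22_sixth_multiLevelBox`
  (`HasMajorant … (toLin′ (opBoxR 1 0 0 1 N * gml)) (C·e^{−½δ₀d})`; dictionary `lapOp_one_eq`: `lapOp 1 N = opBoxR 1 0 0 1 N`)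
  BY NAME, with `δ₀ := min`, `C := sum`, `M₁ := max` of the three packages' thresholds and `3L`.
* §3 (v1.2) **`prop22_supEntries_kLevel`** — THE FOUR SUP ENTRIES WITH COMMON CONSTANTS = LITERALLY THE FIRST CONJUNCT of
  `B6.Prop22Printed (fun i : KIdx d ℓ => i.geo) (fun i => i.gp)`: `∃ M₁ δ₀ C > 0 ∀ i, Hyp21_22 → M₁ ≤ M → ∀ m λ y y′,
  suppIn λ y′ → gp.e m λ y ≤ C·pref4 (len y) m·e^{−½δ₀·dist y y′}·|λ|` — from `prop22_supEntries126_kLevel` and p21's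
  `B6Prop22AdjMultiLevelBox.prop22_third_multiLevelBox` (entry 3 `G′∇^*_μ`: `HasMajorant … (toLin′ (gml * (dMat μ)ᵀ))
  (C·L^j·e^{−½δ₀d})`, the transposed fixed point of the lineage; dictionary **`dstar_one_eq`**: `dstar 1 μ T = T * (dMat μ)ᵀ`).
* §4 **`kLevel_nonvacuous`** — for every `k ≥ 2` and every threshold `M₁` a member with `M ≥ M₁` whose geometry has blocks
  at the two top levels `k − 1` and `k` (`KIdx.twoTop`); the trivial members `Domains.top` (one level) exist for every `k`.
* §5 (v1.1) **`kLevel_nonvacuous3`** — for every `k ≥ 3` and every threshold `M₁` a member with `M ≥ M₁` whose geometry has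
  blocks at the THREE levels `k`, `k − 1`, `k − 2` (`KIdx.threeTop`: `Ω_k` = one big `k`-block, `Ω_{k−1}` = the cube of
  `(3L)^{d+1}` big `(k−1)`-blocks around it, `R = 2L`), for which THE SEPARATION (2.2) IS ACTIVE and verified
  (`dist(Ω_{k−1}^c, Ω_k) > R·M·L^{k−1}` in the coordinate where the outer site leaves the cube).

## HONEST SCOPE (what is NOT certified here)

(1) THE FIRST CONJUNCT ONLY: the Hölder entries 4, 5 (second conjunct of `B6.Prop22Printed`) for the `k`-level operator are
not in the tree (the `k`-level lineage certifies the four sup entries), and the census quantifier order `∃ δ₀ ∀ α` would in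
addition need the `α`-uniform rate of the [3]-level root — the two-level case of all six entries (Hölder per `α`) is
`B6Prop22TwoLevelCensus`; nothing of this is assumed here (no hypothesis, no fact).  (2) LATTICE UNITS (`η = 1`, as the
lineage: `G′` here is `η^{−2}·G′` of print, `len y = L^j` for «L^jη»); FOR THE FOUR SUP ENTRIES the `η`-lattice form differs
by the homogeneity rescaling only (`e_m ↦ η^{(2,1,1,0)_m}e_m`, `len ↦ η·len`: the first conjunct is unit-invariant).  NOT SO
FOR THE HÖLDER SLOT (v1.4 note, r03 g13): print's `‖·‖_α` is `η^{−α}`× the lattice seminorm `hq` (`η = L^{−k}`), so print's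
`(L^jη)^{1−α}(‖ζ‖_α + |ζ|)` reads `(L^j)^{1−α}(L^{kα}·hq ζ + |ζ|)` in lattice units, whereas the census Hölder conjunct
evaluated on `(KIdx.geo, KIdx.gp)` (`cutH = hq + supF`, `len = L^j`) would demand `(L^j)^{1−α}(hq ζ + |ζ|)` — stronger than
print by `L^{kα}` on the `‖ζ‖_α` term and not what the product rule gives from `sup|∇G′λ| = O(L^j)`, `[∇G′λ]_α =
O((L^j)^{1−α})`.  The census HÖLDER conjunct on the `k`-level family is therefore to be read on the PRINT-UNIT rescaling
`…B6Prop22KLevelCensusEta.geoP`/`gpP` (`η := L^{−k}`; there: the Hölder conjunct per `α` and both conjuncts per `α`), not on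
`(geo, gp)`; `geo`/`gp` stay the dictionary of record for the sup conjunct.
(3) CARRIER: the Neumann box of the lineage for `Ω₁`, levels `1 … k` (print: torus `T_η`, levels `0 … k`
with `Λ₀`, `a₀`); bonds of (2.46) across interfaces read as «the two blocks touch» (reading R2 of GAPS G-B6-22; print
under-specifies them).  (4) `R ≥ 2L` is a field of the member (p21's hypothesis; print fixes `R` «later», subject to (2.59));
the (2.59)-type product condition `N₀ + 1 ≤ RM` is absorbed into `M ≥ M₁`.  (5) Lemma 2.1 for these geometries is p21's
`B6Geom246MultiLevelBox.lemma21_box` (constant `K261`, `L`-dependent); its packaging as `DagBinding.B6Lemma21Param` under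
print's threshold (2.59) alone is NOT claimed (under reading R2 the `K261` summability threshold exceeds (2.59) for
mid-range `α` at large `L`, G-B6-22 (iii)).  (6) `m² = 0`, `a = 1`, `A = 0`; constants existential (closed terms of the
lineage's constants).  (7) Non-vacuity exhibits two levels (§4, (2.2) void) and three levels with (2.2) active (§5); deeper
nested shapes are not constructed here (the theorems quantify over all of them).

Value = the census sentence (2.67), sup part verbatim (first conjunct of `B6.Prop22Printed`), on honest `k`-level multiscale
geometries — the first census-form conjunct of a [B6] proposition on a family with arbitrarily many levels —, by reduction to
kernel-checked theorems; NOT summit progress (the Yang–Mills statements are untouched).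

v1.3 (r03 g13, DOC-ONLY, summit-lit1 QF49-003): the docstring of `lapOp_one_eq` quoted «Δ^η_Ω … with Neumann boundary conditions» as if
printed at (2.13) p.225; the printed phrases are «Δ′_a = Δ + Q′*aQ′» (p.225) and «e.g. with Neumann boundary conditions as in [3]» (p.229,
at (2.37)–(2.38)); citation corrected, no declaration changed.
v1.4 (r03 g13, DOC-ONLY): HONEST SCOPE (2) amended — the lattice-unit dictionary is exact for the four SUP entries only; the
census HÖLDER conjunct on the `k`-level family is read on the print-unit rescaling `…B6Prop22KLevelCensusEta.geoP`/`gpP`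
(unit note there and in (2) below); no declaration changed.
-/

noncomputable section

open scoped BigOperators
open Finset Matrix

namespace Literature.MathematicalPhysics.QuantumFieldTheory.Balaban1983to89.B6Prop22KLevelCensus

open Literature.MathematicalPhysics.QuantumFieldTheory.Balaban1983to89.B4ContourShift (supNorm abs_le_supNorm supNorm_nonneg)
open Literature.MathematicalPhysics.QuantumFieldTheory.Balaban1983to89.B4Reflection242 (boxDom mem_boxDom blk avgK diagK
  neumannLapK)
open Literature.MathematicalPhysics.QuantumFieldTheory.Balaban1983to89.B4BoxCov237 (opBoxR)
open Literature.MathematicalPhysics.QuantumFieldTheory.Balaban1983to89.B4Thm110ZeroBox (blk_blk)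
open Literature.MathematicalPhysics.QuantumFieldTheory.Balaban1983to89.B4Lemma22ZeroBoxDerivDual (fwd fwd_val_of_mem fwd_of_not_mem)
open Literature.MathematicalPhysics.QuantumFieldTheory.Balaban1983to89.B6MultiLevelBoxOperator (N0 bigSide Domains aPrinted
  aPrinted_window aPrinted_succ gml one_le_bigSide)
open Literature.MathematicalPhysics.QuantumFieldTheory.Balaban1983to89.B6Geom246MultiLevelBox (bset blkOf geom bond
  exists_blkOf_eq lev_eq_of_blkOf_eq scale_bounds)
open Literature.MathematicalPhysics.QuantumFieldTheory.Balaban1983to89.B6Ineq243TwoLevelBox (aNext)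
open Literature.MathematicalPhysics.QuantumFieldTheory.Balaban1983to89.B6Ineq243AdjTwoLevelBox (dstar dstar_apply)
open Literature.MathematicalPhysics.QuantumFieldTheory.Balaban1983to89.B6Prop22LapTwoLevelBox (lapOp lapOp_apply)
open Literature.MathematicalPhysics.QuantumFieldTheory.Balaban1983to89.B6Prop22MultiLevelBox (prop22_first_multiLevelBox)
open Literature.MathematicalPhysics.QuantumFieldTheory.Balaban1983to89.B6Prop22DerivMultiLevelBox (dMat dMat_mulVec_of_mem
  dMat_mulVec_of_not_mem prop22_second_multiLevelBox)
open Literature.MathematicalPhysics.QuantumFieldTheory.Balaban1983to89.B6Prop22LapMultiLevelBox (prop22_sixth_multiLevelBox)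
open Literature.MathematicalPhysics.QuantumFieldTheory.Balaban1983to89.B6Prop22AdjMultiLevelBox (prop22_third_multiLevelBox)
open Literature.MathematicalPhysics.QuantumFieldTheory.Balaban1983to89.B6RandomWalk (HasMajorant BlockSupp)
open Literature.MathematicalPhysics.QuantumFieldTheory.Balaban1983to89.B6 (Geometry GpFamily Prop22Printed pref4)

variable {d : ℕ}

/-! ## §1 The index family of all nested families (2.1)–(2.2) on the box and the genuine `k`-level operator -/

/-- **INDEX OF THE `k`-LEVEL FAMILY** (`d`, `L = ℓ + 1` fixed): `k ≥ 1` levels, big-block parameter `M_h ≥ 1` (`M = L·M_h`),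
the integer `R ≥ 2L` of (2.2) («a big positive integer which will be fixed later»), box half-widths `P_μ ≥ 1` (fine box
`X = Π_μ[0, L^{k+1}M_hP_μ)`), and the nested family itself as its level function `D` ((2.1) = `D.bigBlocks`, (2.2) = `D.sep`).
[cite: Balaban1984PropagatorsII, (2.1)–(2.4) p.224] -/
structure KIdx (d ℓ : ℕ) where
  k : ℕ
  Mh : ℕ
  R : ℕ
  P : Fin (d + 1) → ℕ
  D : Domains d ℓ Mh k P R
  hk : 1 ≤ k
  hMh : 1 ≤ Mh
  hR : 2 * (ℓ + 1) ≤ R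
  hP : ∀ μ, 1 ≤ P μ

namespace KIdx

variable {ℓ : ℕ} (i : KIdx d ℓ)

/-- the side vector of the fine box of the member. [cite: Balaban1984PropagatorsII, (2.1) p.224, dictionary] -/
abbrev NB : Fin (d + 1) → ℕ := N0 ℓ i.Mh i.k i.P

/-- the fine box `X = Ω₁` of the member. [cite: Balaban1984PropagatorsII, (2.1) p.224 («Ω₁»), dictionary] -/
abbrev XB : Finset (Fin (d + 1) → ℤ) := boxDom i.NB

/-- the origin as a site of the fine box (the box is non-empty). [cite: Balaban1984PropagatorsII, (2.1) p.224, dictionary] -/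
def origin : ↥(i.XB) :=
  ⟨0, by
    rw [mem_boxDom]; intro μ
    have : 1 ≤ i.NB μ :=
      Nat.one_le_iff_ne_zero.2 (Nat.mul_ne_zero_iff.2 ⟨by positivity,
        Nat.mul_ne_zero_iff.2 ⟨by omega, Nat.mul_ne_zero_iff.2 ⟨by have := i.hMh; omega, by have := i.hP μ; omega⟩⟩⟩)
    simp only [Pi.zero_apply]; exact ⟨le_rfl, by exact_mod_cast this⟩⟩

/-- the origin has coordinates `0`. [cite: Balaban1984PropagatorsII, (2.1) p.224, dictionary] -/
@[simp] theorem origin_val : (i.origin).1 = 0 := rfl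

/-- the fine box is non-empty (needed for the suprema `sup_x`). [cite: Balaban1984PropagatorsII, (2.1) p.224, dictionary] -/
instance : Nonempty ↥(i.XB) := ⟨i.origin⟩

/-- **THE GENUINE `k`-LEVEL OPERATOR OF THE MEMBER** `G′ = Δ′_a⁻¹ = gml` with the PRINTED weights `a_j = B1.aSeq 1 L j`
(`a₁ = a = 1`, recursion (2.14)), `m² = 0`. [cite: Balaban1984PropagatorsII, p.225 («The operator G′ = Δ′_a^{−1}»), (2.13)–(2.14) p.225, Prop. 2.2 p.234 («(a = 1)»)] -/
def G : Matrix ↥(i.XB) ↥(i.XB) ℝ := gml i.NB ℓ i.k i.D.lev (aPrinted ℓ 1)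

/-! ## §2 The census geometry of the member and the (2.67) functionals of `G′` -/

/-- the sup norm `|λ| = sup_x |λ(x)|`. [cite: Balaban1984PropagatorsII, Prop. 2.2 (2.67) p.234 («|λ|»)] -/
def supF (f : ↥(i.XB) → ℝ) : ℝ := ⨆ x : ↥(i.XB), |f x|


open Classical in
/-- the lattice Hölder seminorm `‖f‖_α = sup_{x ≠ x′}|f(x′) − f(x)|/|x′ − x|_∞^α` (lattice units `η = 1`).
[cite: Balaban1984PropagatorsII, Prop. 2.2 (2.67) p.234 («‖ζ‖_α»); Balaban1984PropagatorsI, (1.109) p.35] -/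
def hq (α : ℝ) (f : ↥(i.XB) → ℝ) : ℝ :=
  ⨆ p : ↥(i.XB) × ↥(i.XB), if p.1 ≠ p.2 then |f p.2 - f p.1| / (supNorm (p.2.1 - p.1.1)) ^ α else 0

open Classical in
/-- the Hölder seminorm of a `μ`-bond function over pairs of sites which both carry a `μ`-bond of the box.
[cite: Balaban1984PropagatorsII, Prop. 2.2 (2.67) p.234 («‖ζ∇G′λ‖_α»), dictionary] -/
def hqB (μ : Fin (d + 1)) (α : ℝ) (f : ↥(i.XB) → ℝ) : ℝ :=
  ⨆ p : ↥(i.XB) × ↥(i.XB), if p.1 ≠ p.2 ∧ p.1.1 + Pi.single μ 1 ∈ i.XB ∧ p.2.1 + Pi.single μ 1 ∈ i.XB then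
    |f p.2 - f p.1| / (supNorm (p.2.1 - p.1.1)) ^ α else 0

open Classical in
/-- **THE CENSUS GEOMETRY OF THE MEMBER**: p21's realised geometry `geom D` (sites `𝔅`, `scale` = level, `dist` = (2.46)
realised, `η = 1`, `L`) with `M := L·M_h`, `R := R`, the localisation vocabulary of (2.67) on real lattice functions
(`supp λ ⊂ B(y′)` via `blkOf`, `|λ| = supF`, `‖·‖_α = hq`); `Hyp21_22 = True` is inherited from `geom` — (2.1)–(2.2) are
the fields of `D`. [cite: Balaban1984PropagatorsII, (2.1)–(2.4) p.224, (2.45)–(2.46) p.231, Prop. 2.2 (2.67) p.234] -/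
def geo : Geometry :=
  { geom i.D with
    R := i.R
    M := ((ℓ : ℝ) + 1) * i.Mh
    Loc := ↥(i.XB) → ℝ
    suppIn := fun f s => ∀ x, f x ≠ 0 → blkOf i.D x = s
    supNorm := i.supF
    l2Norm := fun f => Real.sqrt (∑ x, f x ^ 2)
    holder := i.hq
    Cut := ↥(i.XB) → ℝ
    cutIn := fun ζ s => ∀ x, ζ x ≠ 0 → blkOf i.D x = s
    cutH := fun α ζ => i.hq α ζ + i.supF ζ
    cutSup := i.supF }

/-- the sites of the census geometry are the blocks `𝔅` of the member. [cite: Balaban1984PropagatorsII, (2.45) p.231, dictionary] -/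
@[simp] theorem geo_Site : i.geo.Site = ↥(bset i.D) := rfl
/-- `dist` = the realised distance (2.46). [cite: Balaban1984PropagatorsII, (2.46) p.231, dictionary] -/
theorem geo_dist (s t : ↥(bset i.D)) : i.geo.dist s t = (((bond i.D).dist s t : ℕ) : ℝ) := rfl
/-- `scale` = the level of the block. [cite: Balaban1984PropagatorsII, (2.45) p.231, dictionary] -/
theorem geo_scale (s : ↥(bset i.D)) : i.geo.scale s = s.1.1 := rfl
/-- `supp λ ⊂ B(y′)` unfolded. [cite: Balaban1984PropagatorsII, Prop. 2.2 p.234 («for λ with supp λ ⊂ B^{j′}(y′)»), dictionary] -/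
theorem geo_suppIn (f : ↥(i.XB) → ℝ) (s : ↥(bset i.D)) : i.geo.suppIn f s ↔ ∀ x, f x ≠ 0 → blkOf i.D x = s := Iff.rfl
/-- `L^jη = L^j` in the lattice units of the lineage. [cite: Balaban1984PropagatorsII, (2.67) p.234 (the factors L^jη), dictionary] -/
theorem geo_len (s : ↥(bset i.D)) : i.geo.len s = ((ℓ : ℝ) + 1) ^ s.1.1 * 1 := rfl

open Classical in
/-- entry (2.67)₁: `sup_{x ∈ B^j(y)} |(G′λ)(x)|`. [cite: Balaban1984PropagatorsII, Prop. 2.2 (2.67) p.234] -/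
def e0 (f : ↥(i.XB) → ℝ) (s : ↥(bset i.D)) : ℝ :=
  ⨆ x : ↥(i.XB), if blkOf i.D x = s then |(i.G *ᵥ f) x| else 0

open Classical in
/-- entry (2.67)₂: `sup_{x ∈ B^j(y), μ} |(∇_μG′λ)(x)|` (forward difference along the `μ`-bonds of the box, lattice units).
[cite: Balaban1984PropagatorsII, Prop. 2.2 (2.67) p.234] -/
def e1 (f : ↥(i.XB) → ℝ) (s : ↥(bset i.D)) : ℝ :=
  ⨆ p : ↥(i.XB) × Fin (d + 1), if blkOf i.D p.1 = s then |(i.G *ᵥ f) (fwd i.NB p.2 p.1) - (i.G *ᵥ f) p.1| else 0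

open Classical in
/-- entry (2.67)₃: `sup_{x ∈ B^j(y), μ} |(G′∇*_μλ)(x)|` (component `μ`; kernel `dstar`). [cite: Balaban1984PropagatorsII, Prop. 2.2 (2.67) p.234] -/
def e2 (f : ↥(i.XB) → ℝ) (s : ↥(bset i.D)) : ℝ :=
  ⨆ p : ↥(i.XB) × Fin (d + 1), if blkOf i.D p.1 = s then |(dstar 1 p.2 i.G *ᵥ f) p.1| else 0

open Classical in
/-- entry (2.67)₆: `sup_{x ∈ B^j(y)} |(ΔG′λ)(x)|` (`lapOp 1` = `−Δ^N_X` in lattice units). [cite: Balaban1984PropagatorsII, Prop. 2.2 (2.67) p.234] -/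
def e3 (f : ↥(i.XB) → ℝ) (s : ↥(bset i.D)) : ℝ :=
  ⨆ x : ↥(i.XB), if blkOf i.D x = s then |((lapOp 1 i.NB * i.G) *ᵥ f) x| else 0

/-- the Hölder entries (2.67)₄,₅: `max_μ max(‖ζ∇_μG′λ‖_α, ‖ζG′∇*_μλ‖_α)` (bond pairs for the bond function, site pairs for
the site function). [cite: Balaban1984PropagatorsII, Prop. 2.2 (2.67) p.234] -/
def hH (f : ↥(i.XB) → ℝ) (α : ℝ) (ζ : ↥(i.XB) → ℝ) : ℝ :=
  ⨆ p : Fin (d + 1) × Bool, if p.2 then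
      i.hqB p.1 α (fun x => ζ x * ((i.G *ᵥ f) (fwd i.NB p.1 x) - (i.G *ᵥ f) x))
    else i.hq α (fun x => ζ x * (dstar 1 p.1 i.G *ᵥ f) x)

/-- **THE (2.67) FUNCTIONALS OF `G′` ON THE MEMBER** in the census record `B6.GpFamily`. [cite: Balaban1984PropagatorsII, Prop. 2.2 (2.67) p.234] -/
def gp : GpFamily i.geo where
  e := ![i.e0, i.e1, i.e2, i.e3]
  h1 := i.hH

/-- a block-supported `λ` in the sense of the census (`suppIn λ y′`) is `BlockSupp` with the bound `|λ|` in the majorant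
language of `B6RandomWalk`. [cite: Balaban1984PropagatorsII, Prop. 2.2 p.234 («supp λ ⊂ B^{j′}(y′)»), (2.51) p.232, dictionary] -/
theorem blockSupp_of_suppIn (f : ↥(i.XB) → ℝ) (s : ↥(bset i.D)) (h : ∀ x, f x ≠ 0 → blkOf i.D x = s) :
    BlockSupp (g := geom i.D) (blkOf i.D) f s (i.supF f) where
  nonneg := le_ciSup_of_le (Set.finite_range fun x : ↥(i.XB) => |f x|).bddAbove i.origin (abs_nonneg _)
  bound := fun x _ => le_ciSup (Set.finite_range fun x : ↥(i.XB) => |f x|).bddAbove x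
  off := fun x hx => by by_contra hf; exact hx (h x hf)

end KIdx

/-! ## §3 The first entry of (2.67) in census form on the whole `k`-level family -/

open KIdx in
/-- **PROPOSITION 2.2 (2.67)₁ IN THE CENSUS TYPING ON THE GENUINE `k`-LEVEL FAMILY** — the `m = 0` instance of the first
conjunct of the verbatim `B6.Prop22Printed (fun i : KIdx d ℓ => i.geo) (fun i => i.gp)`: there are `M₁, δ₀, C > 0`
(depending on `d`, `L` only) such that for EVERY nested family (2.1)–(2.2) on the box — every number of levels `k ≥ 1`, every
volume, every `R ≥ 2L` — with `M = L·M_h ≥ M₁` («M sufficiently large»), every `λ` with `supp λ ⊂ B(y′)` and every block `y`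
of level `j`: `sup_{x ∈ B(y)}|(G′λ)(x)| ≤ C·(L^jη)²·e^{−½δ₀·d(y,y′)}·|λ|`, `d` = the REALISED distance (2.46), `G′ = Δ′_a⁻¹`
the genuine `k`-level operator with the printed weights.  From p21's `prop22_first_multiLevelBox` by name.
[cite: Balaban1984PropagatorsII, Prop. 2.2 (2.67) p.234 (first entry); (2.64)–(2.66) p.234; (2.46) p.231] -/
theorem prop22_entry1_kLevel (d ℓ : ℕ) (hℓ : 1 ≤ ℓ) :
    ∃ M₁ δ₀ C : ℝ, 0 < M₁ ∧ 0 < δ₀ ∧ 0 < C ∧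
      ∀ i : KIdx d ℓ, i.geo.Hyp21_22 → M₁ ≤ i.geo.M →
        ∀ (lam : i.geo.Loc) (y y' : i.geo.Site), i.geo.suppIn lam y' →
          i.gp.e 0 lam y ≤ C * pref4 (i.geo.len y) 0 * Real.exp (-(δ₀ / 2 * i.geo.dist y y')) * i.geo.supNorm lam := by
  classical
  -- the windows of the printed weights: a_j = aPrinted ℓ 1 j ∈ [1 − L^{−2}, 1], c_j = a = 1
  set amin : ℝ := 1 - ((((ℓ : ℝ) + 1)) ^ 2)⁻¹ with hamin_def
  have hL2 : (1 : ℝ) < (((ℓ : ℝ) + 1)) ^ 2 := by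
    have : (2 : ℝ) ≤ (ℓ : ℝ) + 1 := by
      have : (1 : ℝ) ≤ ℓ := by exact_mod_cast hℓ
      linarith
    nlinarith
  have hamin : 0 < amin := by
    rw [hamin_def, sub_pos]
    exact inv_lt_one_of_one_lt₀ hL2
  obtain ⟨δ₀, C, M0, N₀, hδ₀, hC, hM0, hN₀, hAll⟩ := prop22_first_multiLevelBox d ℓ hℓ amin 1 1 1 hamin one_pos
  refine ⟨max (max M0 ((N₀ : ℝ) + 1)) (3 * ((ℓ : ℝ) + 1)), δ₀, C,
    lt_max_of_lt_left (lt_max_of_lt_left hM0), hδ₀, hC, ?_⟩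
  intro i _ hM lam y y' hsupp
  change ↥(i.XB) → ℝ at lam
  change _ ≤ ((ℓ : ℝ) + 1) * i.Mh at hM
  -- «M sufficiently large»: M₀ ≤ L·M_h, M_h ≥ 3, N₀ + 1 ≤ R·(L·M_h)
  have hM0' : M0 ≤ ((ℓ : ℝ) + 1) * i.Mh := le_trans (le_trans (le_max_left _ _) (le_max_left _ _)) hM
  have hL : (0 : ℝ) < (ℓ : ℝ) + 1 := by positivity
  have hMh3 : 3 ≤ i.Mh := by
    have h3 : 3 * ((ℓ : ℝ) + 1) ≤ ((ℓ : ℝ) + 1) * i.Mh := le_trans (le_max_right _ _) hM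
    have : (3 : ℝ) ≤ i.Mh := by nlinarith
    exact_mod_cast this
  have hRM : N₀ + 1 ≤ i.R * ((ℓ + 1) * i.Mh) := by
    have h1 : ((N₀ : ℝ) + 1) ≤ ((ℓ : ℝ) + 1) * i.Mh := le_trans (le_trans (le_max_right _ _) (le_max_left _ _)) hM
    have h2 : N₀ + 1 ≤ (ℓ + 1) * i.Mh := by exact_mod_cast h1
    have hR1 : 1 ≤ i.R := le_trans (by omega) i.hR
    calc N₀ + 1 ≤ 1 * ((ℓ + 1) * i.Mh) := by rw [one_mul]; exact h2
      _ ≤ i.R * ((ℓ + 1) * i.Mh) := Nat.mul_le_mul_right _ hR1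
  -- the printed weights lie in the windows and obey the recursion (2.14)
  have hwin : ∀ j, 1 ≤ j → amin ≤ aPrinted ℓ 1 j ∧ aPrinted ℓ 1 j ≤ 1 := by
    intro j hj
    obtain ⟨h1, h2, _⟩ := aPrinted_window hℓ one_pos hj
    exact ⟨by rw [one_mul] at h1; exact h1, h2⟩
  have hrec : ∀ j, 1 ≤ j → aPrinted ℓ 1 (j + 1) = aNext ℓ (aPrinted ℓ 1 j) ((fun _ : ℕ => (1 : ℝ)) j) :=
    fun j hj => aPrinted_succ hℓ one_pos hj
  -- p21's (2.67)₁ majorant for THIS member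
  have hmaj := hAll i.k i.Mh i.R hMh3 hM0' i.hR hRM i.P i.hP i.D (aPrinted ℓ 1) (fun _ => 1) hwin
    (fun j _ => ⟨le_rfl, le_rfl⟩) hrec
  -- read it on the block-supported `λ`
  rw [geo_suppIn] at hsupp
  have hBS := i.blockSupp_of_suppIn lam y' hsupp
  change i.e0 lam y ≤ C * pref4 (i.geo.len y) 0 * Real.exp (-(δ₀ / 2 * i.geo.dist y y')) * i.supF lam
  have hE0 : 0 ≤ C * pref4 (i.geo.len y) 0 * Real.exp (-(δ₀ / 2 * i.geo.dist y y')) * i.supF lam := by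
    have := hBS.nonneg
    have : 0 ≤ pref4 (i.geo.len y) 0 := by simp only [pref4, Matrix.cons_val_zero]; positivity
    positivity
  unfold KIdx.e0
  refine ciSup_le fun x => ?_
  split_ifs with hx
  · have h := hmaj y' lam (i.supF lam) hBS x
    rw [Matrix.toLin'_apply, hx] at h
    refine h.trans (le_of_eq ?_)
    rw [geo_len]
    simp only [pref4, Matrix.cons_val_zero, mul_one, ← pow_mul, mul_comm 2 _]
    rfl
  · exact hE0

namespace KIdx

variable {ℓ : ℕ} (i : KIdx d ℓ)

/-- the two Laplacian presentations agree in lattice units: `lapOp 1 N = opBoxR 1 0 0 1 N = −Δ^N_X`.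
[cite: Balaban1984PropagatorsII, (2.13) p.225 («Δ′_a = Δ + Q′*aQ′») + p.229 («e.g. with Neumann boundary conditions as in [3]»), dictionary] -/
theorem lapOp_one_eq : lapOp 1 i.NB = opBoxR 1 0 0 1 i.NB := by
  ext x y
  rw [lapOp_apply]
  simp [opBoxR, diagK, avgK]

/-- the forward difference of entry 2 in the two presentations: `(∂_μG′λ)(x) = (G′λ)(fwd_μ x) − (G′λ)(x)`.
[cite: Balaban1984PropagatorsII, (2.67) p.234 (the entry ∇G′λ), dictionary] -/
theorem dMat_G_mulVec (μ : Fin (d + 1)) (f : ↥(i.XB) → ℝ) (x : ↥(i.XB)) :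
    ((dMat i.NB μ * i.G) *ᵥ f) x = (i.G *ᵥ f) (fwd i.NB μ x) - (i.G *ᵥ f) x := by
  rw [← Matrix.mulVec_mulVec]
  by_cases h : x.1 + Pi.single μ 1 ∈ i.XB
  · rw [dMat_mulVec_of_mem μ h]
    have hf : fwd i.NB μ x = ⟨x.1 + Pi.single μ 1, h⟩ := Subtype.ext (fwd_val_of_mem μ x h)
    rw [hf]
  · rw [dMat_mulVec_of_not_mem μ h, fwd_of_not_mem μ x h, sub_self]

/-- `G′∇^*_μ = G′·∂_μᵀ` in lattice units: the column-differenced kernel `dstar 1 μ T` of the two-level lineage IS `T * (dMat μ)ᵀ` of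
the `k`-level lineage (entry 3 of (2.67) in the two presentations). [cite: Balaban1984PropagatorsII, (2.67) p.234 (the entry G′∇*λ), dictionary] -/
theorem dstar_one_eq {N : Fin (d + 1) → ℕ} (μ : Fin (d + 1)) (T : Matrix ↥(boxDom N) ↥(boxDom N) ℝ) :
    dstar 1 μ T = T * (dMat N μ)ᵀ := by
  ext x z
  rw [dstar_apply, Matrix.mul_apply]
  simp only [Matrix.transpose_apply, Nat.cast_one, one_mul]
  unfold dMat
  by_cases h : z.1 + Pi.single μ 1 ∈ boxDom N
  · simp only [h, if_true]
    have hf : fwd N μ z = ⟨z.1 + Pi.single μ 1, h⟩ := Subtype.ext (fwd_val_of_mem μ z h)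
    rw [hf]
    have key : ∀ w : ↥(boxDom N), T x w * ((if w.1 = z.1 + Pi.single μ 1 then (1 : ℝ) else 0) - (if w = z then 1 else 0))
        = (if w = ⟨z.1 + Pi.single μ 1, h⟩ then T x w else 0) - (if w = z then T x w else 0) := by
      intro w
      by_cases hw1 : w = ⟨z.1 + Pi.single μ 1, h⟩
      · have hw1' : w.1 = z.1 + Pi.single μ 1 := congrArg Subtype.val hw1
        rw [if_pos hw1', if_pos hw1]
        split_ifs <;> ring
      · have hw1' : ¬ (w.1 = z.1 + Pi.single μ 1) := fun hh => hw1 (Subtype.ext hh)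
        rw [if_neg hw1', if_neg hw1]
        split_ifs <;> ring
    rw [Finset.sum_congr rfl fun w _ => key w, Finset.sum_sub_distrib, Finset.sum_ite_eq' Finset.univ,
      Finset.sum_ite_eq' Finset.univ, if_pos (Finset.mem_univ _), if_pos (Finset.mem_univ _)]
  · simp only [h, if_false, mul_zero, Finset.sum_const_zero]
    rw [fwd_of_not_mem μ z h, sub_self]

/-- the windows of the printed weights `a_j = B1.aSeq 1 L j ∈ [1 − L^{−2}, 1]` and the recursion (2.14) with `a = 1`.
[cite: Balaban1984PropagatorsII, (2.14) p.225; Balaban1982Higgs1, (2.15) p.609] -/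
theorem aPrinted_windows {ℓ : ℕ} (hℓ : 1 ≤ ℓ) :
    (∀ j, 1 ≤ j → 1 - ((((ℓ : ℝ) + 1)) ^ 2)⁻¹ ≤ aPrinted ℓ 1 j ∧ aPrinted ℓ 1 j ≤ 1) ∧
    (∀ j, 1 ≤ j → aPrinted ℓ 1 (j + 1) = aNext ℓ (aPrinted ℓ 1 j) ((fun _ : ℕ => (1 : ℝ)) j)) := by
  refine ⟨fun j hj => ?_, fun j hj => aPrinted_succ hℓ one_pos hj⟩
  obtain ⟨h1, h2, _⟩ := aPrinted_window hℓ one_pos hj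
  exact ⟨by rw [one_mul] at h1; exact h1, h2⟩

end KIdx

open KIdx in
/-- **PROPOSITION 2.2 (2.67), ENTRIES 1, 2 AND 6, IN THE CENSUS TYPING ON THE GENUINE `k`-LEVEL FAMILY** (v1.1) — the
instances `m = 0, 1, 3` of the first conjunct of `B6.Prop22Printed (fun i : KIdx d ℓ => i.geo) (fun i => i.gp)` WITH COMMON
CONSTANTS: `∃ M₁ δ₀ C > 0` (functions of `d`, `L`) `∀ i, Hyp21_22 → M₁ ≤ M → ∀ m ≠ 2, ∀ λ y y′, suppIn λ y′ →
gp.e m λ y ≤ C·pref4 (len y) m·e^{−½δ₀·dist y y′}·|λ|` — `sup_{x ∈ B(y)}|(G′λ)(x)| ≤ C(L^j)²…`, `sup_{x ∈ B(y), μ}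
|(∇_μG′λ)(x)| ≤ CL^j…`, `sup_{x ∈ B(y)}|(ΔG′λ)(x)| ≤ C…` for EVERY nested family on the box, every number of levels.
From p21's `prop22_first_multiLevelBox` (entry 1), `prop22_second_multiLevelBox` (entry 2, `dMat μ * gml`;
`dMat_G_mulVec`) and `prop22_sixth_multiLevelBox` (entry 6, `opBoxR 1 0 0 1 N * gml = lapOp 1 N * gml`; `lapOp_one_eq`)
BY NAME, with `δ₀ := min`, `C := sum`, `M₁ := max` of the three packages' constants and `3L`.  Entry 3 (`G′∇*`, `m = 2`)
for the `k`-level operator is not in the tree. [cite: Balaban1984PropagatorsII, Prop. 2.2 (2.67) p.234 (entries 1, 2, 6); (2.46) p.231] -/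
theorem prop22_supEntries126_kLevel (d ℓ : ℕ) (hℓ : 1 ≤ ℓ) :
    ∃ M₁ δ₀ C : ℝ, 0 < M₁ ∧ 0 < δ₀ ∧ 0 < C ∧
      ∀ i : KIdx d ℓ, i.geo.Hyp21_22 → M₁ ≤ i.geo.M → ∀ m : Fin 4, m ≠ 2 →
        ∀ (lam : i.geo.Loc) (y y' : i.geo.Site), i.geo.suppIn lam y' →
          i.gp.e m lam y ≤ C * pref4 (i.geo.len y) m * Real.exp (-(δ₀ / 2 * i.geo.dist y y')) * i.geo.supNorm lam := by
  classical
  set amin : ℝ := 1 - ((((ℓ : ℝ) + 1)) ^ 2)⁻¹ with hamin_def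
  have hL2 : (1 : ℝ) < (((ℓ : ℝ) + 1)) ^ 2 := by
    have : (2 : ℝ) ≤ (ℓ : ℝ) + 1 := by
      have : (1 : ℝ) ≤ ℓ := by exact_mod_cast hℓ
      linarith
    nlinarith
  have hamin : 0 < amin := by
    rw [hamin_def, sub_pos]
    exact inv_lt_one_of_one_lt₀ hL2
  obtain ⟨hwin, hrec⟩ := KIdx.aPrinted_windows hℓ
  obtain ⟨δ₁, C₁, M₁', N₁, hδ₁, hC₁, hM₁', hN₁, hA1⟩ := prop22_first_multiLevelBox d ℓ hℓ amin 1 1 1 hamin one_pos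
  obtain ⟨δ₂, C₂, M₂', N₂, hδ₂, hC₂, hM₂', hN₂, hA2⟩ := prop22_second_multiLevelBox d ℓ hℓ amin 1 1 1 hamin one_pos
  obtain ⟨δ₆, C₆, M₆', N₆, hδ₆, hC₆, hM₆', hN₆, hA6⟩ := prop22_sixth_multiLevelBox d ℓ hℓ amin 1 1 1 hamin one_pos
  -- common constants
  set δ₀ : ℝ := min δ₁ (min δ₂ δ₆) with hδ₀
  set C : ℝ := C₁ + C₂ + C₆ with hC
  set M₁ : ℝ := max (max (max M₁' (max M₂' M₆')) (((max N₁ (max N₂ N₆) : ℕ) : ℝ) + 1)) (3 * ((ℓ : ℝ) + 1)) with hM₁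
  have hδ₀pos : 0 < δ₀ := lt_min hδ₁ (lt_min hδ₂ hδ₆)
  refine ⟨M₁, δ₀, C, lt_of_lt_of_le hM₁' (le_trans (le_trans (le_max_left _ _) (le_max_left _ _)) (le_max_left _ _)),
    hδ₀pos, by positivity, ?_⟩
  intro i _ hM m hm lam y y' hsupp
  change ↥(i.XB) → ℝ at lam
  change M₁ ≤ ((ℓ : ℝ) + 1) * i.Mh at hM
  -- «M sufficiently large» for all three packages
  have hMa : max M₁' (max M₂' M₆') ≤ ((ℓ : ℝ) + 1) * i.Mh :=
    le_trans (le_trans (le_max_left _ _) (le_max_left _ _)) hM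
  have hL : (0 : ℝ) < (ℓ : ℝ) + 1 := by positivity
  have hMh3 : 3 ≤ i.Mh := by
    have h3 : 3 * ((ℓ : ℝ) + 1) ≤ ((ℓ : ℝ) + 1) * i.Mh := le_trans (le_max_right _ _) hM
    have : (3 : ℝ) ≤ i.Mh := by nlinarith
    exact_mod_cast this
  have hRM : ∀ N : ℕ, N ≤ max N₁ (max N₂ N₆) → N + 1 ≤ i.R * ((ℓ + 1) * i.Mh) := by
    intro N hN
    have h1 : (((max N₁ (max N₂ N₆) : ℕ) : ℝ) + 1) ≤ ((ℓ : ℝ) + 1) * i.Mh :=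
      le_trans (le_trans (le_max_right _ _) (le_max_left _ _)) hM
    have h2 : max N₁ (max N₂ N₆) + 1 ≤ (ℓ + 1) * i.Mh := by exact_mod_cast h1
    have hR1 : 1 ≤ i.R := le_trans (by omega) i.hR
    calc N + 1 ≤ 1 * ((ℓ + 1) * i.Mh) := by rw [one_mul]; omega
      _ ≤ i.R * ((ℓ + 1) * i.Mh) := Nat.mul_le_mul_right _ hR1
  rw [geo_suppIn] at hsupp
  have hBS := i.blockSupp_of_suppIn lam y' hsupp
  have hB0 : 0 ≤ i.supF lam := hBS.nonneg
  -- the common exponential and the comparison of the three packages' bounds with the common one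
  set E : ℝ := Real.exp (-(δ₀ / 2 * i.geo.dist y y')) with hE
  have hdist0 : 0 ≤ i.geo.dist y y' := by rw [geo_dist]; exact Nat.cast_nonneg _
  have hEmono : ∀ δ : ℝ, δ₀ ≤ δ → Real.exp (-(δ / 2 * (geom i.D).dist y y')) ≤ E := by
    intro δ hδ
    rw [hE]; apply Real.exp_le_exp.2
    have : (geom i.D).dist y y' = i.geo.dist y y' := rfl
    rw [this]; nlinarith
  have hlen : i.geo.len y = ((ℓ : ℝ) + 1) ^ y.1.1 := by rw [geo_len, mul_one]
  have hpref0 : ∀ m : Fin 4, 0 ≤ pref4 (i.geo.len y) m := by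
    intro m; rw [hlen]; fin_cases m <;> simp [pref4] <;> positivity
  have htarget0 : 0 ≤ C * pref4 (i.geo.len y) m * E * i.supF lam := by
    have := hpref0 m; positivity
  change i.gp.e m lam y ≤ C * pref4 (i.geo.len y) m * E * i.supF lam
  -- generic step: a package bound `Cₘ·pref·e^{−½δₘ d}·B` is below the common bound
  have step : ∀ (Cm δm v : ℝ), 0 ≤ Cm → Cm ≤ C → δ₀ ≤ δm →
      |v| ≤ Cm * pref4 (i.geo.len y) m * Real.exp (-(δm / 2 * (geom i.D).dist y y')) * i.supF lam →
      |v| ≤ C * pref4 (i.geo.len y) m * E * i.supF lam := by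
    intro Cm δm v hCm hCmC hδm hv
    refine hv.trans ?_
    have h1 : Cm * pref4 (i.geo.len y) m * Real.exp (-(δm / 2 * (geom i.D).dist y y')) * i.supF lam
        ≤ Cm * pref4 (i.geo.len y) m * E * i.supF lam :=
      mul_le_mul_of_nonneg_right (mul_le_mul_of_nonneg_left (hEmono δm hδm)
        (mul_nonneg hCm (hpref0 m))) hB0
    have h2 : Cm * pref4 (i.geo.len y) m * E * i.supF lam ≤ C * pref4 (i.geo.len y) m * E * i.supF lam := by
      have : 0 ≤ pref4 (i.geo.len y) m * E * i.supF lam := by have := hpref0 m; positivity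
      nlinarith
    exact h1.trans h2
  have hC1le : C₁ ≤ C := by rw [hC]; linarith
  have hC2le : C₂ ≤ C := by rw [hC]; linarith
  have hC6le : C₆ ≤ C := by rw [hC]; linarith
  have hδ01 : δ₀ ≤ δ₁ := min_le_left _ _
  have hδ02 : δ₀ ≤ δ₂ := le_trans (min_le_right _ _) (min_le_left _ _)
  have hδ06 : δ₀ ≤ δ₆ := le_trans (min_le_right _ _) (min_le_right _ _)
  fin_cases m
  · -- entry 1: |(G′λ)(x)|, prefactor (L^j)²
    have hmaj := hA1 i.k i.Mh i.R hMh3 (le_trans (le_max_left _ _) hMa) i.hR (hRM N₁ (le_max_left _ _)) i.P i.hP i.D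
      (aPrinted ℓ 1) (fun _ => 1) hwin (fun j _ => ⟨le_rfl, le_rfl⟩) hrec
    have hp : pref4 (i.geo.len y) 0 = (i.geo.len y) ^ 2 := rfl
    show i.e0 lam y ≤ C * pref4 (i.geo.len y) 0 * E * i.supF lam
    unfold KIdx.e0
    refine ciSup_le fun x => ?_
    split_ifs with hx
    · have h := hmaj y' lam (i.supF lam) hBS x
      rw [Matrix.toLin'_apply, hx] at h
      refine step C₁ δ₁ _ hC₁.le hC1le hδ01 (h.trans (le_of_eq ?_))
      show _ = C₁ * pref4 (i.geo.len y) 0 * _ * _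
      beta_reduce
      rw [hp, hlen]
      ring
    · exact htarget0
  · -- entry 2: |(∇_μG′λ)(x)|, prefactor L^j
    have hmaj := hA2 i.k i.Mh i.R hMh3 (le_trans (le_trans (le_max_left _ _) (le_max_right _ _)) hMa) i.hR
      (hRM N₂ (le_trans (le_max_left _ _) (le_max_right _ _))) i.P i.hP i.D (aPrinted ℓ 1) (fun _ => 1) hwin
      (fun j _ => ⟨le_rfl, le_rfl⟩) hrec
    have hp : pref4 (i.geo.len y) 1 = i.geo.len y := rfl
    show i.e1 lam y ≤ C * pref4 (i.geo.len y) 1 * E * i.supF lam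
    unfold KIdx.e1
    refine ciSup_le fun p => ?_
    split_ifs with hx
    · have h := hmaj p.2 y' lam (i.supF lam) hBS p.1
      rw [Matrix.toLin'_apply, hx] at h
      have h' : |(i.G *ᵥ lam) (fwd i.NB p.2 p.1) - (i.G *ᵥ lam) p.1|
          ≤ C₂ * ((ℓ : ℝ) + 1) ^ y.1.1 * Real.exp (-(δ₂ / 2 * (geom i.D).dist y y')) * i.supF lam := by
        rw [← dMat_G_mulVec]; exact h
      refine step C₂ δ₂ _ hC₂.le hC2le hδ02 (h'.trans (le_of_eq ?_))
      show _ = C₂ * pref4 (i.geo.len y) 1 * _ * _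
      rw [hp, hlen]
    · exact htarget0
  · -- entry 3 is excluded
    exact absurd rfl hm
  · -- entry 6: |(ΔG′λ)(x)|, prefactor 1
    have hmaj := hA6 i.k i.Mh i.R hMh3 (le_trans (le_trans (le_max_right _ _) (le_max_right _ _)) hMa) i.hR
      (hRM N₆ (le_trans (le_max_right _ _) (le_max_right _ _))) i.P i.hP i.D (aPrinted ℓ 1) (fun _ => 1) hwin
      (fun j _ => ⟨le_rfl, le_rfl⟩) hrec
    have hp : pref4 (i.geo.len y) 3 = 1 := rfl
    show i.e3 lam y ≤ C * pref4 (i.geo.len y) 3 * E * i.supF lam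
    unfold KIdx.e3
    refine ciSup_le fun x => ?_
    split_ifs with hx
    · have h := hmaj y' lam (i.supF lam) hBS x
      rw [Matrix.toLin'_apply, hx] at h
      have h' : |((lapOp 1 i.NB * i.G) *ᵥ lam) x| ≤ C₆ * Real.exp (-(δ₆ / 2 * (geom i.D).dist y y')) * i.supF lam := by
        rw [lapOp_one_eq]; exact h
      refine step C₆ δ₆ _ hC₆.le hC6le hδ06 (h'.trans (le_of_eq ?_))
      show _ = C₆ * pref4 (i.geo.len y) 3 * _ * _
      rw [hp, mul_one]
    · exact htarget0

open KIdx in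
/-- **PROPOSITION 2.2 (2.67), THE FOUR SUP ENTRIES, IN THE CENSUS TYPING ON THE GENUINE `k`-LEVEL FAMILY** (v1.2) — LITERALLY
THE FIRST CONJUNCT of the verbatim `B6.Prop22Printed (fun i : KIdx d ℓ => i.geo) (fun i => i.gp)` over the index family of ALL
nested families (2.1)–(2.2) on the Neumann box (every number of levels `k ≥ 1`, every volume, every `R ≥ 2L`): there are
`M₁, δ₀, C > 0` (depending on `d`, `L` only) such that for every member with `M = L·M_h ≥ M₁` («M sufficiently large»), every
entry `m ∈ {0,1,2,3}` (= (2.67)₁,₂,₃,₆), every `λ` with `supp λ ⊂ B^{j′}(y′)` and every block `y`: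
`e_m(λ, y) ≤ C·[(L^jη)², L^jη, L^jη, 1]_m·e^{−½δ₀·d(y,y′)}·|λ|`, `d` = the REALISED distance (2.46), `G′ = Δ′_a⁻¹` the genuine
`k`-level operator with the printed weights (`a = 1`).  From `prop22_supEntries126_kLevel` (entries 1, 2, 6) and p21's
`B6Prop22AdjMultiLevelBox.prop22_third_multiLevelBox` (entry 3, `gml * (dMat μ)ᵀ`; dictionary `dstar_one_eq`) BY NAME, with
`δ₀ := min`, `C := sum`, `M₁ := max`. [cite: Balaban1984PropagatorsII, Prop. 2.2 (2.67) p.234 (entries 1–3 and 6); (2.46) p.231] -/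
theorem prop22_supEntries_kLevel (d ℓ : ℕ) (hℓ : 1 ≤ ℓ) :
    ∃ M₁ δ₀ C : ℝ, 0 < M₁ ∧ 0 < δ₀ ∧ 0 < C ∧
      ∀ i : KIdx d ℓ, i.geo.Hyp21_22 → M₁ ≤ i.geo.M →
        ∀ (m : Fin 4) (lam : i.geo.Loc) (y y' : i.geo.Site), i.geo.suppIn lam y' →
          i.gp.e m lam y ≤ C * pref4 (i.geo.len y) m * Real.exp (-(δ₀ / 2 * i.geo.dist y y')) * i.geo.supNorm lam := by
  classical
  set amin : ℝ := 1 - ((((ℓ : ℝ) + 1)) ^ 2)⁻¹ with hamin_def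
  have hL2 : (1 : ℝ) < (((ℓ : ℝ) + 1)) ^ 2 := by
    have : (2 : ℝ) ≤ (ℓ : ℝ) + 1 := by
      have : (1 : ℝ) ≤ ℓ := by exact_mod_cast hℓ
      linarith
    nlinarith
  have hamin : 0 < amin := by
    rw [hamin_def, sub_pos]
    exact inv_lt_one_of_one_lt₀ hL2
  obtain ⟨hwin, hrec⟩ := KIdx.aPrinted_windows hℓ
  obtain ⟨M', δ', C', hM', hδ', hC', h126⟩ := prop22_supEntries126_kLevel d ℓ hℓ
  obtain ⟨δ₃, C₃, M₃', N₃, hδ₃, hC₃, hM₃', hN₃, hA3⟩ := prop22_third_multiLevelBox d ℓ hℓ amin 1 1 1 hamin one_pos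
  set δ₀ : ℝ := min δ' δ₃ with hδ₀
  set C : ℝ := C' + C₃ with hC
  set M₁ : ℝ := max M' (max (max M₃' ((N₃ : ℝ) + 1)) (3 * ((ℓ : ℝ) + 1))) with hM₁
  refine ⟨M₁, δ₀, C, lt_of_lt_of_le hM' (le_max_left _ _), lt_min hδ' hδ₃, by positivity, ?_⟩
  intro i hHyp hM m lam y y' hsupp
  have hM126 : M' ≤ i.geo.M := le_trans (le_max_left _ _) hM
  have hdist0 : 0 ≤ i.geo.dist y y' := by rw [geo_dist]; exact Nat.cast_nonneg _
  have hlen : i.geo.len y = ((ℓ : ℝ) + 1) ^ y.1.1 := by rw [geo_len, mul_one]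
  have hpref0 : 0 ≤ pref4 (i.geo.len y) m := by rw [hlen]; fin_cases m <;> simp [pref4] <;> positivity
  have hB0 : 0 ≤ i.geo.supNorm lam := by
    change 0 ≤ i.supF lam
    exact le_ciSup_of_le (Set.finite_range fun x : ↥(i.XB) => |lam x|).bddAbove i.origin (abs_nonneg _)
  set E : ℝ := Real.exp (-(δ₀ / 2 * i.geo.dist y y')) with hE
  have hEmono : ∀ δ : ℝ, δ₀ ≤ δ → Real.exp (-(δ / 2 * i.geo.dist y y')) ≤ E := by
    intro δ hδ; rw [hE]; apply Real.exp_le_exp.2; nlinarith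
  -- generic comparison of a package bound with the common one
  have step : ∀ (Cm δm v : ℝ), 0 ≤ Cm → Cm ≤ C → δ₀ ≤ δm →
      v ≤ Cm * pref4 (i.geo.len y) m * Real.exp (-(δm / 2 * i.geo.dist y y')) * i.geo.supNorm lam →
      v ≤ C * pref4 (i.geo.len y) m * E * i.geo.supNorm lam := by
    intro Cm δm v hCm hCmC hδm hv
    refine hv.trans ?_
    have h1 : Cm * pref4 (i.geo.len y) m * Real.exp (-(δm / 2 * i.geo.dist y y')) * i.geo.supNorm lam
        ≤ Cm * pref4 (i.geo.len y) m * E * i.geo.supNorm lam :=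
      mul_le_mul_of_nonneg_right (mul_le_mul_of_nonneg_left (hEmono δm hδm) (mul_nonneg hCm hpref0)) hB0
    have h2 : Cm * pref4 (i.geo.len y) m * E * i.geo.supNorm lam ≤ C * pref4 (i.geo.len y) m * E * i.geo.supNorm lam := by
      have : 0 ≤ pref4 (i.geo.len y) m * E * i.geo.supNorm lam := by positivity
      nlinarith
    exact h1.trans h2
  by_cases hm : m = 2
  · -- entry 3: |(G′∇^*_μ λ)(x)|, prefactor L^j, from p21's transposed fixed point
    subst hm
    change ↥(i.XB) → ℝ at lam
    change M₁ ≤ ((ℓ : ℝ) + 1) * i.Mh at hM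
    have hM3 : M₃' ≤ ((ℓ : ℝ) + 1) * i.Mh := le_trans (le_trans (le_max_left _ _) (le_max_left _ _)) (le_trans (le_max_right _ _) hM)
    have hL : (0 : ℝ) < (ℓ : ℝ) + 1 := by positivity
    have hMh3 : 3 ≤ i.Mh := by
      have h3 : 3 * ((ℓ : ℝ) + 1) ≤ ((ℓ : ℝ) + 1) * i.Mh := le_trans (le_trans (le_max_right _ _) (le_max_right _ _)) hM
      have : (3 : ℝ) ≤ i.Mh := by nlinarith
      exact_mod_cast this
    have hRM : N₃ + 1 ≤ i.R * ((ℓ + 1) * i.Mh) := by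
      have h1 : ((N₃ : ℝ) + 1) ≤ ((ℓ : ℝ) + 1) * i.Mh :=
        le_trans (le_trans (le_max_right _ _) (le_max_left _ _)) (le_trans (le_max_right _ _) hM)
      have h2 : N₃ + 1 ≤ (ℓ + 1) * i.Mh := by exact_mod_cast h1
      have hR1 : 1 ≤ i.R := le_trans (by omega) i.hR
      calc N₃ + 1 ≤ 1 * ((ℓ + 1) * i.Mh) := by rw [one_mul]; exact h2
        _ ≤ i.R * ((ℓ + 1) * i.Mh) := Nat.mul_le_mul_right _ hR1
    have hmaj := hA3 i.k i.Mh i.R hMh3 hM3 i.hR hRM i.P i.hP i.D (aPrinted ℓ 1) (fun _ => 1) hwin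
      (fun j _ => ⟨le_rfl, le_rfl⟩) hrec
    rw [geo_suppIn] at hsupp
    have hBS := i.blockSupp_of_suppIn lam y' hsupp
    have hp : pref4 (i.geo.len y) 2 = i.geo.len y := rfl
    have hC3le : C₃ ≤ C := by rw [hC]; linarith
    have hδ03 : δ₀ ≤ δ₃ := min_le_right _ _
    have htarget0 : 0 ≤ C * pref4 (i.geo.len y) 2 * E * i.geo.supNorm lam := by positivity
    show i.e2 lam y ≤ C * pref4 (i.geo.len y) 2 * E * i.supF lam
    unfold KIdx.e2
    refine ciSup_le fun p => ?_
    split_ifs with hx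
    · have h := hmaj p.2 y' lam (i.supF lam) hBS p.1
      rw [Matrix.toLin'_apply, hx] at h
      have h' : |(dstar 1 p.2 i.G *ᵥ lam) p.1|
          ≤ C₃ * ((ℓ : ℝ) + 1) ^ y.1.1 * Real.exp (-(δ₃ / 2 * (geom i.D).dist y y')) * i.supF lam := by
        rw [dstar_one_eq]; exact h
      refine step C₃ δ₃ _ hC₃.le hC3le hδ03 (h'.trans (le_of_eq ?_))
      show _ = C₃ * pref4 (i.geo.len y) 2 * _ * _
      rw [hp, hlen]
      rfl
    · exact htarget0
  · -- entries 1, 2, 6: the v1.1 package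
    have h := h126 i hHyp hM126 m hm lam y y' hsupp
    have hC'le : C' ≤ C := by rw [hC]; linarith
    exact step C' δ' _ hC'.le hC'le (min_le_left _ _) h

/-! ## §4 Non-vacuity: members with the two top levels present beyond every threshold «M sufficiently large» -/

namespace KIdx

/-- the level function of the member with ONE big block of the top level `k` (label `0`), level `k − 1` elsewhere.
[cite: Balaban1984PropagatorsII, (2.1) p.224] -/
def topLev (ℓ k Mh : ℕ) (x : Fin (d + 1) → ℤ) : ℕ := if blk (bigSide ℓ Mh k) x = 0 then k else k - 1

/-- `topLev ∈ {k − 1, k}`. [cite: Balaban1984PropagatorsII, (2.1) p.224, dictionary] -/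
theorem topLev_eq_or (ℓ k Mh : ℕ) (x : Fin (d + 1) → ℤ) : topLev (d := d) ℓ k Mh x = k ∨ topLev (d := d) ℓ k Mh x = k - 1 := by
  unfold topLev; split_ifs <;> simp

/-- **THE TWO-TOP-LEVEL MEMBER** on the box of two big `k`-blocks per direction: `Ω₁ = … = Ω_{k−1} = X`, `Ω_k` = the big
`k`-block at the origin; (2.1) by construction, (2.2) void. [cite: Balaban1984PropagatorsII, (2.1)–(2.2) p.224] -/
def twoTop (d ℓ k Mh : ℕ) (hk : 2 ≤ k) (hMh : 1 ≤ Mh) : KIdx d ℓ where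
  k := k
  Mh := Mh
  R := 2 * (ℓ + 1)
  P := fun _ => 2
  D :=
    { lev := topLev ℓ k Mh
      one_le_lev := fun x => by rcases topLev_eq_or (d := d) ℓ k Mh x with h | h <;> omega
      lev_le := fun x => by rcases topLev_eq_or (d := d) ℓ k Mh x with h | h <;> omega
      bigBlocks := by
        intro j hj x _ x' _ hb
        by_cases hjk : j ≤ k - 1
        · constructor <;> intro _
          · rcases topLev_eq_or (d := d) ℓ k Mh x' with h | h <;> omega
          · rcases topLev_eq_or (d := d) ℓ k Mh x with h | h <;> omega
        by_cases hje : j = k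
        · subst hje
          have key : ∀ y : Fin (d + 1) → ℤ, j ≤ topLev (d := d) ℓ j Mh y ↔ blk (bigSide ℓ Mh j) y = 0 := by
            intro y; unfold topLev; split_ifs with h
            · simp [h]
            · simp only [h, iff_false, not_le]; omega
          rw [key, key, hb]
        · constructor <;> intro h
          · rcases topLev_eq_or (d := d) ℓ k Mh x with e | e <;> omega
          · rcases topLev_eq_or (d := d) ℓ k Mh x' with e | e <;> omega
      sep := by
        intro j x _ x' _ h1 h2
        rcases topLev_eq_or (d := d) ℓ k Mh x with e | e <;> rcases topLev_eq_or (d := d) ℓ k Mh x' with e' | e' <;>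
          simp only [e, e'] at h1 h2 <;> omega }
  hk := by omega
  hMh := hMh
  hR := le_rfl
  hP := fun _ => by norm_num

/-- the origin has level `k` in `twoTop`. [cite: Balaban1984PropagatorsII, (2.1) p.224] -/
theorem twoTop_lev_zero (d ℓ k Mh : ℕ) (hk : 2 ≤ k) (hMh : 1 ≤ Mh) :
    (twoTop d ℓ k Mh hk hMh).D.lev 0 = k := by
  show topLev (d := d) ℓ k Mh 0 = k
  unfold topLev
  have hb : blk (bigSide ℓ Mh k) (0 : Fin (d + 1) → ℤ) = 0 := by funext μ; simp [blk]
  rw [if_pos hb]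

/-- the corner of the neighbouring big block (first direction) is a site of the box … [cite: Balaban1984PropagatorsII, (2.1) p.224] -/
theorem twoTop_corner_mem (d ℓ k Mh : ℕ) (hk : 2 ≤ k) (hMh : 1 ≤ Mh) :
    (fun μ : Fin (d + 1) => if μ = 0 then ((bigSide ℓ Mh k : ℕ) : ℤ) else 0) ∈ (twoTop d ℓ k Mh hk hMh).XB := by
  rw [mem_boxDom]; intro μ
  have hside : (twoTop d ℓ k Mh hk hMh).NB μ = 2 * bigSide ℓ Mh k := by
    simp only [NB, N0, twoTop, bigSide]; ring
  rw [hside]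
  have hpos : 1 ≤ bigSide ℓ Mh k := one_le_bigSide hMh _
  split_ifs
  · constructor
    · positivity
    · push_cast; linarith [(show (1 : ℤ) ≤ bigSide ℓ Mh k by exact_mod_cast hpos)]
  · constructor
    · exact le_rfl
    · push_cast; positivity

/-- … and has level `k − 1`. [cite: Balaban1984PropagatorsII, (2.1) p.224] -/
theorem twoTop_lev_corner (d ℓ k Mh : ℕ) (hk : 2 ≤ k) (hMh : 1 ≤ Mh) :
    (twoTop d ℓ k Mh hk hMh).D.lev (fun μ : Fin (d + 1) => if μ = 0 then ((bigSide ℓ Mh k : ℕ) : ℤ) else 0) = k - 1 := by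
  show topLev (d := d) ℓ k Mh _ = k - 1
  unfold topLev
  have hpos : 1 ≤ bigSide ℓ Mh k := one_le_bigSide hMh _
  have hb : blk (bigSide ℓ Mh k) (fun μ : Fin (d + 1) => if μ = 0 then ((bigSide ℓ Mh k : ℕ) : ℤ) else 0)
      = fun μ => if μ = 0 then 1 else 0 := by
    funext μ; simp only [blk]
    have hne : ((bigSide ℓ Mh k : ℕ) : ℤ) ≠ 0 := by exact_mod_cast (by omega : bigSide ℓ Mh k ≠ 0)
    split_ifs
    · exact Int.ediv_self hne
    · simp
  have hnot : (fun μ : Fin (d + 1) => if μ = 0 then (1 : ℤ) else 0) ≠ 0 := by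
    intro h
    have := congrFun h 0; simp at this
  rw [hb, if_neg hnot]

end KIdx

open KIdx in
/-- **NON-VACUITY OF THE `k`-LEVEL FAMILY**: for every `k ≥ 2` and every threshold `M₁` there is a member with `M = L·M_h ≥ M₁`
whose geometry has blocks at BOTH top levels `k` and `k − 1` (so `prop22_entry1_kLevel` speaks about multiscale geometries
with the level-dependent factor `L^{2j}` and the realised distance (2.46) beyond every threshold; the separation (2.2) is void
for this witness). [cite: Balaban1984PropagatorsII, (2.1)–(2.2) p.224, Prop. 2.2 p.234 («M is sufficiently large»)] -/
theorem kLevel_nonvacuous (d ℓ k : ℕ) (hk : 2 ≤ k) (M₁ : ℝ) :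
    ∃ i : KIdx d ℓ, i.k = k ∧ M₁ ≤ i.geo.M ∧ i.geo.Hyp21_22 ∧
      (∃ s : i.geo.Site, i.geo.scale s = k) ∧ (∃ s : i.geo.Site, i.geo.scale s = k - 1) := by
  set Mh : ℕ := max 1 ⌈M₁⌉₊ with hMh_def
  have hMh : 1 ≤ Mh := le_max_left _ _
  refine ⟨twoTop d ℓ k Mh hk hMh, rfl, ?_, trivial, ?_, ?_⟩
  · change M₁ ≤ ((ℓ : ℝ) + 1) * ((twoTop d ℓ k Mh hk hMh).Mh : ℝ)
    have h1 : M₁ ≤ (Mh : ℝ) := le_trans (Nat.le_ceil M₁) (by exact_mod_cast le_max_right 1 ⌈M₁⌉₊)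
    have h2 : (Mh : ℝ) ≤ ((ℓ : ℝ) + 1) * Mh := by
      have : (0 : ℝ) ≤ Mh := Nat.cast_nonneg Mh
      nlinarith [(Nat.cast_nonneg ℓ : (0 : ℝ) ≤ ℓ)]
    exact h1.trans (by exact_mod_cast h2)
  · refine ⟨blkOf (twoTop d ℓ k Mh hk hMh).D (twoTop d ℓ k Mh hk hMh).origin, ?_⟩
    rw [geo_scale, ← lev_eq_of_blkOf_eq (D := (twoTop d ℓ k Mh hk hMh).D) rfl]
    exact twoTop_lev_zero d ℓ k Mh hk hMh
  · refine ⟨blkOf (twoTop d ℓ k Mh hk hMh).D ⟨_, twoTop_corner_mem d ℓ k Mh hk hMh⟩, ?_⟩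
    rw [geo_scale, ← lev_eq_of_blkOf_eq (D := (twoTop d ℓ k Mh hk hMh).D) rfl]
    exact twoTop_lev_corner d ℓ k Mh hk hMh

/-! ## §5 Non-vacuity with the separation (2.2) ACTIVE: members with THREE levels present (v1.1) -/

namespace KIdx

/-- the level function of the three-top-level member (`k = k′ + 3`): level `k` on the big `k`-block at the origin, level
`k − 1` on the cube of `(3L)^{d+1}` big `(k−1)`-blocks at the origin, level `k − 2` elsewhere — so that `Ω_{k−1}^c` and
`Ω_k` are `2L` big `(k−1)`-blocks apart, as (2.2) with `R = 2L` demands. [cite: Balaban1984PropagatorsII, (2.1)–(2.2) p.224] -/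
def threeLev (ℓ k' Mh : ℕ) (x : Fin (d + 1) → ℤ) : ℕ :=
  if blk (bigSide ℓ Mh (k' + 3)) x = 0 then k' + 3
  else if ∀ ν, blk (bigSide ℓ Mh (k' + 2)) x ν < 3 * ((ℓ : ℤ) + 1) then k' + 2 else k' + 1

/-- `threeLev ∈ {k′+1, k′+2, k′+3}`. [cite: Balaban1984PropagatorsII, (2.1) p.224, dictionary] -/
theorem threeLev_cases (ℓ k' Mh : ℕ) (x : Fin (d + 1) → ℤ) :
    threeLev (d := d) ℓ k' Mh x = k' + 1 ∨ threeLev (d := d) ℓ k' Mh x = k' + 2 ∨ threeLev (d := d) ℓ k' Mh x = k' + 3 := by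
  unfold threeLev; split_ifs <;> simp

/-- `Ω_k = {k ≤ lev}` is the big top block at the origin. [cite: Balaban1984PropagatorsII, (2.1) p.224, dictionary] -/
theorem three_le_threeLev_iff (ℓ k' Mh : ℕ) (x : Fin (d + 1) → ℤ) :
    k' + 3 ≤ threeLev (d := d) ℓ k' Mh x ↔ blk (bigSide ℓ Mh (k' + 3)) x = 0 := by
  unfold threeLev; split_ifs with h1 h2
  · simp [h1]
  · simp only [h1, iff_false, not_le]; omega
  · simp only [h1, iff_false, not_le]; omega

/-- `Ω_{k−1} = {k − 1 ≤ lev}` is the cube of big `(k−1)`-blocks at the origin (it contains `Ω_k`). [cite: Balaban1984PropagatorsII, (2.1) p.224, dictionary] -/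
theorem two_le_threeLev_iff (ℓ k' Mh : ℕ) (x : Fin (d + 1) → ℤ) :
    k' + 2 ≤ threeLev (d := d) ℓ k' Mh x ↔
      (blk (bigSide ℓ Mh (k' + 3)) x = 0 ∨ ∀ ν, blk (bigSide ℓ Mh (k' + 2)) x ν < 3 * ((ℓ : ℤ) + 1)) := by
  unfold threeLev; split_ifs with h1 h2
  · simp [h1]
  · simp [h1, h2]
  · simp only [h1, h2, or_self, iff_false, not_le]; omega

/-- the big `k`-label is a function of the big `(k−1)`-label (blocks nest: `bigSide k = L·bigSide (k−1)`).
[cite: Balaban1984PropagatorsII, (2.1) p.224, dictionary] -/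
theorem blk_top_eq (ℓ k' Mh : ℕ) (x : Fin (d + 1) → ℤ) :
    blk (bigSide ℓ Mh (k' + 3)) x = blk (ℓ + 1) (blk (bigSide ℓ Mh (k' + 2)) x) := by
  rw [blk_blk, B6MultiLevelBoxOperator.bigSide_succ, mul_comm]

/-- **THE THREE-TOP-LEVEL MEMBER** (`k = k′ + 3`, `R = 2L`, box of `3L` big `k`-blocks per direction): (2.1) by the nesting of
big blocks, **(2.2) ACTIVE**: a site below level `k − 1` and a site of level `k` are more than `R·M·L^{k−1} = 2L·bigSide(k−1)`
apart. [cite: Balaban1984PropagatorsII, (2.1)–(2.2) p.224] -/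
def threeTop (d ℓ k' Mh : ℕ) (hMh : 1 ≤ Mh) : KIdx d ℓ where
  k := k' + 3
  Mh := Mh
  R := 2 * (ℓ + 1)
  P := fun _ => 3 * (ℓ + 1)
  D :=
    { lev := threeLev ℓ k' Mh
      one_le_lev := fun x => by rcases threeLev_cases (d := d) ℓ k' Mh x with h | h | h <;> omega
      lev_le := fun x => by rcases threeLev_cases (d := d) ℓ k' Mh x with h | h | h <;> omega
      bigBlocks := by
        intro j hj x _ x' _ hb
        by_cases hj1 : j ≤ k' + 1
        · constructor <;> intro _
          · rcases threeLev_cases (d := d) ℓ k' Mh x' with h | h | h <;> omega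
          · rcases threeLev_cases (d := d) ℓ k' Mh x with h | h | h <;> omega
        by_cases hj2 : j = k' + 2
        · subst hj2
          rw [two_le_threeLev_iff, two_le_threeLev_iff, blk_top_eq, blk_top_eq, hb]
        by_cases hj3 : j = k' + 3
        · subst hj3
          rw [three_le_threeLev_iff, three_le_threeLev_iff, hb]
        · constructor <;> intro h
          · rcases threeLev_cases (d := d) ℓ k' Mh x with e | e | e <;> omega
          · rcases threeLev_cases (d := d) ℓ k' Mh x' with e | e | e <;> omega
      sep := by
        intro j x hx x' hx' h1 h2
        have hx3 := threeLev_cases (d := d) ℓ k' Mh x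
        have hx'3 := threeLev_cases (d := d) ℓ k' Mh x'
        have hj : j = k' + 2 := by rcases hx3 with e | e | e <;> rcases hx'3 with e' | e' | e' <;> omega
        subst hj
        -- `x′ ∈ Ω_k`: all its coordinates lie in `[0, bigSide k)`
        have htop : blk (bigSide ℓ Mh (k' + 3)) x' = 0 :=
          (three_le_threeLev_iff (d := d) ℓ k' Mh x').1 (by omega)
        -- `x ∉ Ω_{k−1}`: some big `(k−1)`-label coordinate is `≥ 3L`
        have hlow : ¬ (k' + 2 ≤ threeLev (d := d) ℓ k' Mh x) := by omega
        rw [two_le_threeLev_iff, not_or, not_forall] at hlow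
        obtain ⟨-, ⟨ν, hν⟩⟩ := hlow
        rw [not_lt] at hν
        set b : ℕ := bigSide ℓ Mh (k' + 2) with hb_def
        have hb1 : 1 ≤ b := one_le_bigSide hMh _
        have hbpos : (0 : ℤ) < b := by exact_mod_cast hb1
        have hB : ((bigSide ℓ Mh (k' + 3) : ℕ) : ℤ) = ((ℓ : ℤ) + 1) * b := by
          rw [B6MultiLevelBoxOperator.bigSide_succ]; push_cast; ring
        -- coordinate bounds
        have hxν : 3 * ((ℓ : ℤ) + 1) * b ≤ x ν := by
          have h := hν
          simp only [blk] at h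
          rwa [Int.le_ediv_iff_mul_le hbpos] at h
        have hx'ν : x' ν < ((ℓ : ℤ) + 1) * b := by
          have h0 : blk (bigSide ℓ Mh (k' + 3)) x' ν = 0 := by rw [htop]; rfl
          simp only [blk] at h0
          have hBpos : (0 : ℤ) < ((bigSide ℓ Mh (k' + 3) : ℕ) : ℤ) := by rw [hB]; positivity
          have := Int.lt_mul_of_ediv_lt hBpos (show x' ν / ((bigSide ℓ Mh (k' + 3) : ℕ) : ℤ) < 1 by rw [h0]; norm_num)
          rw [one_mul, hB] at this
          exact this
        -- the gap in the coordinate `ν` exceeds `R·bigSide(k−1) = 2L·b`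
        have hgap : ((2 * (ℓ + 1) * b : ℕ) : ℤ) < (x - x') ν := by
          rw [Pi.sub_apply]; push_cast; nlinarith
        have h1 : (((2 * (ℓ + 1) * b : ℕ) : ℤ) : ℝ) < (((x - x') ν : ℤ) : ℝ) := by exact_mod_cast hgap
        have h2 : (((x - x') ν : ℤ) : ℝ) ≤ ((|(x - x') ν| : ℤ) : ℝ) := by exact_mod_cast le_abs_self _
        have h3 := abs_le_supNorm (x - x') ν
        have e : ((2 * (ℓ + 1) * bigSide ℓ Mh (k' + 2) : ℕ) : ℝ) = (((2 * (ℓ + 1) * b : ℕ) : ℤ) : ℝ) := by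
          rw [hb_def]; push_cast; ring
        rw [e]
        linarith }
  hk := by omega
  hMh := hMh
  hR := le_rfl
  hP := fun _ => by omega

/-- the side of the box of `threeTop` is `3L` big `k`-blocks. [cite: Balaban1984PropagatorsII, (2.1) p.224, dictionary] -/
theorem threeTop_NB (d ℓ k' Mh : ℕ) (hMh : 1 ≤ Mh) (μ : Fin (d + 1)) :
    (threeTop d ℓ k' Mh hMh).NB μ = bigSide ℓ Mh (k' + 3) * (3 * (ℓ + 1)) := by
  simp only [NB, N0, threeTop, bigSide]; ring

/-- the origin has level `k`. [cite: Balaban1984PropagatorsII, (2.1) p.224] -/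
theorem threeTop_lev_zero (d ℓ k' Mh : ℕ) (hMh : 1 ≤ Mh) : (threeTop d ℓ k' Mh hMh).D.lev 0 = k' + 3 := by
  show threeLev (d := d) ℓ k' Mh 0 = k' + 3
  unfold threeLev
  have hb : blk (bigSide ℓ Mh (k' + 3)) (0 : Fin (d + 1) → ℤ) = 0 := by funext μ; simp [blk]
  rw [if_pos hb]

/-- the site `bigSide(k)·e₀` (corner of the next big `k`-block) lies in the box … [cite: Balaban1984PropagatorsII, (2.1) p.224] -/
theorem threeTop_x1_mem (d ℓ k' Mh : ℕ) (hMh : 1 ≤ Mh) :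
    (fun μ : Fin (d + 1) => if μ = 0 then ((bigSide ℓ Mh (k' + 3) : ℕ) : ℤ) else 0) ∈ (threeTop d ℓ k' Mh hMh).XB := by
  rw [mem_boxDom]; intro μ
  rw [threeTop_NB]
  have hpos : 1 ≤ bigSide ℓ Mh (k' + 3) := one_le_bigSide hMh _
  split_ifs
  · refine ⟨by positivity, ?_⟩
    have : bigSide ℓ Mh (k' + 3) * 1 < bigSide ℓ Mh (k' + 3) * (3 * (ℓ + 1)) :=
      Nat.mul_lt_mul_of_pos_left (by omega) (by omega)
    exact_mod_cast (by simpa using this)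
  · exact ⟨le_rfl, by push_cast; positivity⟩

/-- … and has level `k − 1`. [cite: Balaban1984PropagatorsII, (2.1) p.224] -/
theorem threeTop_lev_x1 (d ℓ k' Mh : ℕ) (hMh : 1 ≤ Mh) :
    (threeTop d ℓ k' Mh hMh).D.lev (fun μ : Fin (d + 1) => if μ = 0 then ((bigSide ℓ Mh (k' + 3) : ℕ) : ℤ) else 0)
      = k' + 2 := by
  show threeLev (d := d) ℓ k' Mh _ = k' + 2
  have hB1 : 1 ≤ bigSide ℓ Mh (k' + 3) := one_le_bigSide hMh _
  have hb1 : 1 ≤ bigSide ℓ Mh (k' + 2) := one_le_bigSide hMh _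
  have hBne : ((bigSide ℓ Mh (k' + 3) : ℕ) : ℤ) ≠ 0 := by exact_mod_cast (by omega : bigSide ℓ Mh (k' + 3) ≠ 0)
  have hbne : ((bigSide ℓ Mh (k' + 2) : ℕ) : ℤ) ≠ 0 := by exact_mod_cast (by omega : bigSide ℓ Mh (k' + 2) ≠ 0)
  have hB : ((bigSide ℓ Mh (k' + 3) : ℕ) : ℤ) = ((ℓ : ℤ) + 1) * bigSide ℓ Mh (k' + 2) := by
    rw [B6MultiLevelBoxOperator.bigSide_succ]; push_cast; ring
  unfold threeLev
  have htop : blk (bigSide ℓ Mh (k' + 3)) (fun μ : Fin (d + 1) => if μ = 0 then ((bigSide ℓ Mh (k' + 3) : ℕ) : ℤ) else 0)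
      ≠ 0 := by
    intro h
    have h0 := congrFun h 0
    simp only [blk, if_true, Pi.zero_apply] at h0
    rw [Int.ediv_self hBne] at h0
    exact one_ne_zero h0
  rw [if_neg htop, if_pos]
  intro ν
  simp only [blk]
  split_ifs
  · rw [hB, Int.mul_ediv_cancel _ hbne]
    have : (0 : ℤ) ≤ ℓ := Nat.cast_nonneg ℓ
    linarith
  · rw [Int.zero_ediv]; positivity

/-- the site `3L·bigSide(k−1)·e₀` lies in the box … [cite: Balaban1984PropagatorsII, (2.1) p.224] -/
theorem threeTop_x2_mem (d ℓ k' Mh : ℕ) (hℓ : 1 ≤ ℓ) (hMh : 1 ≤ Mh) :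
    (fun μ : Fin (d + 1) => if μ = 0 then 3 * ((ℓ : ℤ) + 1) * ((bigSide ℓ Mh (k' + 2) : ℕ) : ℤ) else 0)
      ∈ (threeTop d ℓ k' Mh hMh).XB := by
  have hL : (1 : ℤ) ≤ ℓ := by exact_mod_cast hℓ
  rw [mem_boxDom]; intro μ
  rw [threeTop_NB]
  have hb1 : 1 ≤ bigSide ℓ Mh (k' + 2) := one_le_bigSide hMh _
  have hB1 : 1 ≤ bigSide ℓ Mh (k' + 3) := one_le_bigSide hMh _
  have hB : ((bigSide ℓ Mh (k' + 3) : ℕ) : ℤ) = ((ℓ : ℤ) + 1) * bigSide ℓ Mh (k' + 2) := by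
    rw [B6MultiLevelBoxOperator.bigSide_succ]; push_cast; ring
  split_ifs
  · refine ⟨by positivity, ?_⟩
    push_cast
    rw [hB]
    have hb0 : (0 : ℤ) < bigSide ℓ Mh (k' + 2) := by exact_mod_cast hb1
    nlinarith
  · exact ⟨le_rfl, by push_cast; positivity⟩

end KIdx

namespace KIdx

/-- … and has level `k − 2`. [cite: Balaban1984PropagatorsII, (2.1) p.224] -/
theorem threeTop_lev_x2 (d ℓ k' Mh : ℕ) (hMh : 1 ≤ Mh) :
    (threeTop d ℓ k' Mh hMh).D.lev
        (fun μ : Fin (d + 1) => if μ = 0 then 3 * ((ℓ : ℤ) + 1) * ((bigSide ℓ Mh (k' + 2) : ℕ) : ℤ) else 0) = k' + 1 := by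
  show threeLev (d := d) ℓ k' Mh _ = k' + 1
  have hb1 : 1 ≤ bigSide ℓ Mh (k' + 2) := one_le_bigSide hMh _
  have hbne : ((bigSide ℓ Mh (k' + 2) : ℕ) : ℤ) ≠ 0 := by exact_mod_cast (by omega : bigSide ℓ Mh (k' + 2) ≠ 0)
  have hLne : ((ℓ : ℤ) + 1) ≠ 0 := by positivity
  have hB : ((bigSide ℓ Mh (k' + 3) : ℕ) : ℤ) = ((ℓ : ℤ) + 1) * bigSide ℓ Mh (k' + 2) := by
    rw [B6MultiLevelBoxOperator.bigSide_succ]; push_cast; ring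
  unfold threeLev
  have hq3 : 3 * ((ℓ : ℤ) + 1) * ((bigSide ℓ Mh (k' + 2) : ℕ) : ℤ) / ((bigSide ℓ Mh (k' + 3) : ℕ) : ℤ) = 3 := by
    rw [hB, show 3 * ((ℓ : ℤ) + 1) * ((bigSide ℓ Mh (k' + 2) : ℕ) : ℤ)
      = 3 * (((ℓ : ℤ) + 1) * ((bigSide ℓ Mh (k' + 2) : ℕ) : ℤ)) by ring]
    exact Int.mul_ediv_cancel _ (mul_ne_zero hLne hbne)
  have hqb : 3 * ((ℓ : ℤ) + 1) * ((bigSide ℓ Mh (k' + 2) : ℕ) : ℤ) / ((bigSide ℓ Mh (k' + 2) : ℕ) : ℤ)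
      = 3 * ((ℓ : ℤ) + 1) := Int.mul_ediv_cancel _ hbne
  have htop : blk (bigSide ℓ Mh (k' + 3))
      (fun μ : Fin (d + 1) => if μ = 0 then 3 * ((ℓ : ℤ) + 1) * ((bigSide ℓ Mh (k' + 2) : ℕ) : ℤ) else 0) ≠ 0 := by
    intro h
    have h0 := congrFun h 0
    simp only [blk, if_true, Pi.zero_apply] at h0
    rw [hq3] at h0
    norm_num at h0
  have hmid : ¬ ∀ ν, blk (bigSide ℓ Mh (k' + 2))
      (fun μ : Fin (d + 1) => if μ = 0 then 3 * ((ℓ : ℤ) + 1) * ((bigSide ℓ Mh (k' + 2) : ℕ) : ℤ) else 0) ν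
        < 3 * ((ℓ : ℤ) + 1) := by
    intro h
    have h0 := h 0
    simp only [blk, if_true] at h0
    rw [hqb] at h0
    exact lt_irrefl _ h0
  rw [if_neg htop, if_neg hmid]

end KIdx

open KIdx in
/-- **NON-VACUITY WITH (2.2) ACTIVE**: for every `k ≥ 3` and every threshold `M₁` there is a member of the family with
`M ≥ M₁` whose geometry has blocks at the THREE levels `k`, `k − 1`, `k − 2` (`KIdx.threeTop`: `Ω_k` = one big `k`-block,
`Ω_{k−1}` = a cube of big `(k−1)`-blocks around it at distance `> R·M·L^{k−1}` from `Ω_{k−1}^c`, `R = 2L`) — so the separation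
condition (2.2) constrains this member non-trivially and `prop22_supEntries126_kLevel` is a statement about genuinely
multi-level geometries beyond every threshold. [cite: Balaban1984PropagatorsII, (2.1)–(2.2) p.224, Prop. 2.2 p.234] -/
theorem kLevel_nonvacuous3 (d ℓ k : ℕ) (hℓ : 1 ≤ ℓ) (hk : 3 ≤ k) (M₁ : ℝ) :
    ∃ i : KIdx d ℓ, i.k = k ∧ M₁ ≤ i.geo.M ∧ i.geo.Hyp21_22 ∧
      (∃ s : i.geo.Site, i.geo.scale s = k) ∧ (∃ s : i.geo.Site, i.geo.scale s = k - 1) ∧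
        (∃ s : i.geo.Site, i.geo.scale s = k - 2) := by
  set Mh : ℕ := max 1 ⌈M₁⌉₊ with hMh_def
  have hMh : 1 ≤ Mh := le_max_left _ _
  obtain ⟨k', rfl⟩ : ∃ k', k = k' + 3 := ⟨k - 3, by omega⟩
  refine ⟨threeTop d ℓ k' Mh hMh, rfl, ?_, trivial, ?_, ?_, ?_⟩
  · change M₁ ≤ ((ℓ : ℝ) + 1) * ((threeTop d ℓ k' Mh hMh).Mh : ℝ)
    have h1 : M₁ ≤ (Mh : ℝ) := le_trans (Nat.le_ceil M₁) (by exact_mod_cast le_max_right 1 ⌈M₁⌉₊)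
    have h2 : (Mh : ℝ) ≤ ((ℓ : ℝ) + 1) * Mh := by
      have : (0 : ℝ) ≤ Mh := Nat.cast_nonneg Mh
      nlinarith [(Nat.cast_nonneg ℓ : (0 : ℝ) ≤ ℓ)]
    exact h1.trans (by exact_mod_cast h2)
  · refine ⟨blkOf (threeTop d ℓ k' Mh hMh).D (threeTop d ℓ k' Mh hMh).origin, ?_⟩
    rw [geo_scale, ← lev_eq_of_blkOf_eq (D := (threeTop d ℓ k' Mh hMh).D) rfl]
    exact threeTop_lev_zero d ℓ k' Mh hMh
  · refine ⟨blkOf (threeTop d ℓ k' Mh hMh).D ⟨_, threeTop_x1_mem d ℓ k' Mh hMh⟩, ?_⟩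
    rw [geo_scale, ← lev_eq_of_blkOf_eq (D := (threeTop d ℓ k' Mh hMh).D) rfl]
    rw [threeTop_lev_x1 d ℓ k' Mh hMh]; rfl
  · refine ⟨blkOf (threeTop d ℓ k' Mh hMh).D ⟨_, threeTop_x2_mem d ℓ k' Mh hℓ hMh⟩, ?_⟩
    rw [geo_scale, ← lev_eq_of_blkOf_eq (D := (threeTop d ℓ k' Mh hMh).D) rfl]
    rw [threeTop_lev_x2 d ℓ k' Mh hMh]
    omega

end Literature.MathematicalPhysics.QuantumFieldTheory.Balaban1983to89.B6Prop22KLevelCensus
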